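import Summits.BirchSwinnertonDyer.Rank1Residual.X12.InertCoreEveryCurve
import Literature.NumberTheory.EllipticCurves.DeuringSupersingularReductionHoldsProofs
import HarnessLib

/-!
# X12 inert-bad core at `p ≥ 11`, every curve: the class theorems WITHOUT the Deuring binder

HONEST FRAMING (cell `b2b-bsdres`, run/shared/lean/b2b/bsd-rank1-residual/, verbatim in every
file): the goal of the cell is to DELETE the COMBINATION-SHAPED residual classes of the
Birch–Swinnerton-Dyer formula for ALL analytic-rank `≤ 1` elliptic curves over `ℚ` — "full BSD
formula for every rank `≤ 1` curve in class `C`" assembled STRICTLY from published theorems — so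
that the rank-`≤ 1` remainder becomes exactly the CONSTRUCTION-SHAPED classes, which are TYPED
(missing-input `Prop`s), NOT attempted. This is not "finishing BSD". Class X12 (RESIDUAL-CASES §a.2:
`cm ∧ r = 1 ∧ (p = 2 ∨ (p ∣ N ∧ p not split in K))`) is CONSTRUCTION-SHAPED and stays so; this
file is bookkeeping by the off-peak literature seat `b2b-bsdres-lit-bst` (gen 11) on research-route
records of the unit `b2b-bsdres-x1b`; no claim beyond the stated class; nothing here is booked.

WHAT THIS FILE DOES. `X12/InertCoreEveryCurve.lean` (x1b gen 19) moves the class-level upper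
half of `BSD(E,p)` on the X12 inert-bad core at `p ≥ 11` from the strong curve to EVERY curve of
the class (Modularity supplies the optimal member, Cassels moves the one-sided halves); one of its
binders, `hDeu : deuring_not_hasUnitRootAt_of_hasCM_of_not_cmSplit` (Deuring's criterion,
supersingular half, over every number field), is no longer a hypothesis of the tree but a THEOREM:
`Literature.NumberTheory.EllipticCurves.deuring_not_hasUnitRootAt_of_hasCM_of_not_cmSplit_holds`
(`Literature/NumberTheory/EllipticCurves/DeuringSupersingularReductionHoldsProofs.lean`, p253190).
This file re-issues the six `hDeu`-binding theorems of that file WITHOUT the binder (primed names,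
statements otherwise byte-identical, each proof = the original applied to the `_holds` theorem);
the originals stay for their importers (append-only rule; the 400-line rule forbids appending
there). After this file the sentence "on the inert core at `p ≥ 11`, for EVERY curve,
`BSD(E,p) ⟺ MissingLowerBoundAt W p`" binds ONLY published named facts of the tree (Gross–Zagier,
Kolyvagin, Matar–Nekovář 2019 Thm. 0.3, GZK, modularity, Friedberg–Hoffstein, the rank-0 CM
triple, Edixhoven 1991 Thm. 3, Cassels' isogeny invariance) and the class predicate — no Manin
datum, no optimality, no Deuring hypothesis. Companion file:
`X12/InertCoreManinFreeDeuringFree.lean` (the strong-curve forms of x1b gen 16).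

References: S. Lang, *Elliptic Functions* (GTM 112, 1987) Ch. 13 §4 Thm. 12 [Lang1987];
M. Deuring, Abh. Math. Sem. Hamburg 14 (1941) 197–272 [Deuring1941]; B. Edixhoven, Progr. Math. 89
(1991) 25–39, Thm. 3 [EdixhovenManin1991]; A. Matar, J. Nekovář, JTNB 31 (2019) Thm. 0.3, §0.11
[MatarNekovar2019]; HOME `b2b-bsdres-lit-bst/BST-BCST.md` §14.6 (the discharge) and §15 (this file);
HOME `b2b-bsdres-x1b/X12-ROUTE.md` §20, §23 (the originals).
-/

noncomputable section

open scoped Classical NumberField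

open WeierstrassCurve NumberField IsDedekindDomain Literature.NumberTheory.EllipticCurves
  Literature.NumberTheory.EllipticCurves.ModularForms
  Literature.NumberTheory.EllipticCurves.Rank1Residual
  Literature.NumberTheory.EllipticCurves.Rank1Residual.Typed
  Literature.NumberTheory.Automorphic

namespace Summit.BirchSwinnertonDyer.Rank1Residual.X12

/-- **`hDeu`-free form of `missingUpperBoundAt_of_classX12_of_cmInert`** — the same statement with
the binder `(hDeu : deuring_not_hasUnitRootAt_of_hasCM_of_not_cmSplit)` REMOVED: Deuring's criterion
(supersingular half) is the tree theorem `deuring_not_hasUnitRootAt_of_hasCM_of_not_cmSplit_holds`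
(p253190); proof = the original applied to it. [cite: EdixhovenManin1991, Thm. 3]
[cite: MatarNekovar2019, Thm. 0.3 and §0.11] [cite: BurungaleFlach2024, Thm. 1.1 and Cor. 2]
[cite: MilneADT2006, Thm. I.7.3 and Remark I.7.4] [cite: Lang1987, Ch. 13 §4 Thm. 12] -/
theorem missingUpperBoundAt_of_classX12_of_cmInert'
    (hGZ : ∀ (N : ℕ) [NeZero N] (W : WeierstrassCurve ℚ) (K : Type) [Field K] [NumberField K],
      gross_zagier N W K)
    (hKo : ∀ (N : ℕ) [NeZero N] (W : WeierstrassCurve ℚ) (K : Type) [Field K] [NumberField K],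
      kolyvagin N W K)
    (hMN : ∀ (N : ℕ) [NeZero N] (W : WeierstrassCurve ℚ) (K : Type) [Field K] [NumberField K],
      MatarNekovar2019.thm03_padicValNat_card_sha_le_of_irreducible N W K)
    (hGZK : rank_eq_analyticRank_of_analyticRank_le_one) (hmod : hasEntireLFunction_rat)
    (hnf : exists_isNewformOf) (hFH : friedbergHoffstein_exists_heegnerField_split_twist_ne_zero)
    (hCM8 : bsdTriple_of_hasCM_of_L_one_ne_zero)
    (hEdx : edixhoven_not_dvd_maninConstant_of_not_potentiallyGoodOrdinary)
    (hCassels : bsdRHS_eq_of_isIsogenous)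
    (W : WeierstrassCurve ℚ) [W.IsElliptic] [W.IsGloballyMinimal] (p : ℕ) [Fact p.Prime]
    (hX : ClassX12 W p) (hp7 : 7 < p)
    (hnr : ¬ CMRamified W p) (hns : ¬ CMSplit W p) : MissingUpperBoundAt W p :=
  missingUpperBoundAt_of_classX12_of_cmInert hGZ hKo hMN hGZK hmod hnf hFH hCM8 hEdx
    deuring_not_hasUnitRootAt_of_hasCM_of_not_cmSplit_holds hCassels W p hX hp7 hnr hns

/-- **`hDeu`-free form of `bsdp_of_classX12_of_cmInert_of_lower`** — the same statement with the
binder `(hDeu : deuring_not_hasUnitRootAt_of_hasCM_of_not_cmSplit)` REMOVED: Deuring's criterion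
(supersingular half) is the tree theorem `deuring_not_hasUnitRootAt_of_hasCM_of_not_cmSplit_holds`
(p253190); proof = the original applied to it. [cite: EdixhovenManin1991, Thm. 3]
[cite: MatarNekovar2019, Thm. 0.3 and §0.11] [cite: Lang1987, Ch. 13 §4 Thm. 12] -/
theorem bsdp_of_classX12_of_cmInert_of_lower'
    (hGZ : ∀ (N : ℕ) [NeZero N] (W : WeierstrassCurve ℚ) (K : Type) [Field K] [NumberField K],
      gross_zagier N W K)
    (hKo : ∀ (N : ℕ) [NeZero N] (W : WeierstrassCurve ℚ) (K : Type) [Field K] [NumberField K],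
      kolyvagin N W K)
    (hMN : ∀ (N : ℕ) [NeZero N] (W : WeierstrassCurve ℚ) (K : Type) [Field K] [NumberField K],
      MatarNekovar2019.thm03_padicValNat_card_sha_le_of_irreducible N W K)
    (hGZK : rank_eq_analyticRank_of_analyticRank_le_one) (hmod : hasEntireLFunction_rat)
    (hnf : exists_isNewformOf) (hFH : friedbergHoffstein_exists_heegnerField_split_twist_ne_zero)
    (hCM8 : bsdTriple_of_hasCM_of_L_one_ne_zero)
    (hEdx : edixhoven_not_dvd_maninConstant_of_not_potentiallyGoodOrdinary)
    (hCassels : bsdRHS_eq_of_isIsogenous)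
    (W : WeierstrassCurve ℚ) [W.IsElliptic] [W.IsGloballyMinimal] (p : ℕ) [Fact p.Prime]
    (hX : ClassX12 W p) (hp7 : 7 < p)
    (hnr : ¬ CMRamified W p) (hns : ¬ CMSplit W p) (hlow : MissingLowerBoundAt W p) : BSDp W p :=
  bsdp_of_classX12_of_cmInert_of_lower hGZ hKo hMN hGZK hmod hnf hFH hCM8 hEdx
    deuring_not_hasUnitRootAt_of_hasCM_of_not_cmSplit_holds hCassels W p hX hp7 hnr hns hlow

/-- **`hDeu`-free form of `missingInputAt_of_classX12_of_cmInert_of_lower`** — the same statement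
with the binder `(hDeu : deuring_not_hasUnitRootAt_of_hasCM_of_not_cmSplit)` REMOVED: Deuring's
criterion (supersingular half) is the tree theorem
`deuring_not_hasUnitRootAt_of_hasCM_of_not_cmSplit_holds` (p253190); proof = the original applied to
it. [cite: EdixhovenManin1991, Thm. 3] [cite: MatarNekovar2019, Thm. 0.3 and §0.11]
[cite: Lang1987, Ch. 13 §4 Thm. 12] -/
theorem missingInputAt_of_classX12_of_cmInert_of_lower'
    (hGZ : ∀ (N : ℕ) [NeZero N] (W : WeierstrassCurve ℚ) (K : Type) [Field K] [NumberField K],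
      gross_zagier N W K)
    (hKo : ∀ (N : ℕ) [NeZero N] (W : WeierstrassCurve ℚ) (K : Type) [Field K] [NumberField K],
      kolyvagin N W K)
    (hMN : ∀ (N : ℕ) [NeZero N] (W : WeierstrassCurve ℚ) (K : Type) [Field K] [NumberField K],
      MatarNekovar2019.thm03_padicValNat_card_sha_le_of_irreducible N W K)
    (hGZK : rank_eq_analyticRank_of_analyticRank_le_one) (hmod : hasEntireLFunction_rat)
    (hnf : exists_isNewformOf) (hFH : friedbergHoffstein_exists_heegnerField_split_twist_ne_zero)
    (hCM8 : bsdTriple_of_hasCM_of_L_one_ne_zero)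
    (hEdx : edixhoven_not_dvd_maninConstant_of_not_potentiallyGoodOrdinary)
    (hCassels : bsdRHS_eq_of_isIsogenous)
    (W : WeierstrassCurve ℚ) [W.IsElliptic] [W.IsGloballyMinimal] (p : ℕ) [Fact p.Prime]
    (hX : ClassX12 W p) (hp7 : 7 < p)
    (hnr : ¬ CMRamified W p) (hns : ¬ CMSplit W p) (hlow : MissingLowerBoundAt W p) :
    X12.MissingInputAt W p :=
  missingInputAt_of_classX12_of_cmInert_of_lower hGZ hKo hMN hGZK hmod hnf hFH hCM8 hEdx
    deuring_not_hasUnitRootAt_of_hasCM_of_not_cmSplit_holds hCassels W p hX hp7 hnr hns hlow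

/-- **`hDeu`-free form of `bsdp_iff_missingLowerBoundAt_of_classX12_of_cmInert`** — the same
statement with the binder `(hDeu : deuring_not_hasUnitRootAt_of_hasCM_of_not_cmSplit)` REMOVED:
Deuring's criterion (supersingular half) is the tree theorem
`deuring_not_hasUnitRootAt_of_hasCM_of_not_cmSplit_holds` (p253190); proof = the original applied to
it. [cite: EdixhovenManin1991, Thm. 3] [cite: MatarNekovar2019, Thm. 0.3 and §0.11]
[cite: Miller2011LMS, §1 and Def. 1.1] [cite: Lang1987, Ch. 13 §4 Thm. 12] -/
theorem bsdp_iff_missingLowerBoundAt_of_classX12_of_cmInert'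
    (hGZ : ∀ (N : ℕ) [NeZero N] (W : WeierstrassCurve ℚ) (K : Type) [Field K] [NumberField K],
      gross_zagier N W K)
    (hKo : ∀ (N : ℕ) [NeZero N] (W : WeierstrassCurve ℚ) (K : Type) [Field K] [NumberField K],
      kolyvagin N W K)
    (hMN : ∀ (N : ℕ) [NeZero N] (W : WeierstrassCurve ℚ) (K : Type) [Field K] [NumberField K],
      MatarNekovar2019.thm03_padicValNat_card_sha_le_of_irreducible N W K)
    (hGZK : rank_eq_analyticRank_of_analyticRank_le_one) (hmod : hasEntireLFunction_rat)
    (hnf : exists_isNewformOf) (hFH : friedbergHoffstein_exists_heegnerField_split_twist_ne_zero)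
    (hCM8 : bsdTriple_of_hasCM_of_L_one_ne_zero)
    (hEdx : edixhoven_not_dvd_maninConstant_of_not_potentiallyGoodOrdinary)
    (hCassels : bsdRHS_eq_of_isIsogenous)
    (W : WeierstrassCurve ℚ) [W.IsElliptic] [W.IsGloballyMinimal] (p : ℕ) [Fact p.Prime]
    (hX : ClassX12 W p) (hp7 : 7 < p)
    (hnr : ¬ CMRamified W p) (hns : ¬ CMSplit W p) : BSDp W p ↔ MissingLowerBoundAt W p :=
  bsdp_iff_missingLowerBoundAt_of_classX12_of_cmInert hGZ hKo hMN hGZK hmod hnf hFH hCM8 hEdx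
    deuring_not_hasUnitRootAt_of_hasCM_of_not_cmSplit_holds hCassels W p hX hp7 hnr hns

/-- **`hDeu`-free form of `bsdp_iff_missingLowerBoundAt_of_isIsogenous_of_classX12_of_cmInert`** —
the same statement with the binder `(hDeu : deuring_not_hasUnitRootAt_of_hasCM_of_not_cmSplit)`
REMOVED: Deuring's criterion (supersingular half) is the tree theorem
`deuring_not_hasUnitRootAt_of_hasCM_of_not_cmSplit_holds` (p253190); proof = the original applied to
it. [cite: EdixhovenManin1991, Thm. 3] [cite: MilneADT2006, Thm. I.7.3 and Remark I.7.4]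
[cite: Lang1987, Ch. 13 §4 Thm. 12] -/
theorem bsdp_iff_missingLowerBoundAt_of_isIsogenous_of_classX12_of_cmInert'
    (hGZ : ∀ (N : ℕ) [NeZero N] (W : WeierstrassCurve ℚ) (K : Type) [Field K] [NumberField K],
      gross_zagier N W K)
    (hKo : ∀ (N : ℕ) [NeZero N] (W : WeierstrassCurve ℚ) (K : Type) [Field K] [NumberField K],
      kolyvagin N W K)
    (hMN : ∀ (N : ℕ) [NeZero N] (W : WeierstrassCurve ℚ) (K : Type) [Field K] [NumberField K],
      MatarNekovar2019.thm03_padicValNat_card_sha_le_of_irreducible N W K)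
    (hGZK : rank_eq_analyticRank_of_analyticRank_le_one) (hmod : hasEntireLFunction_rat)
    (hnf : exists_isNewformOf) (hFH : friedbergHoffstein_exists_heegnerField_split_twist_ne_zero)
    (hCM8 : bsdTriple_of_hasCM_of_L_one_ne_zero)
    (hEdx : edixhoven_not_dvd_maninConstant_of_not_potentiallyGoodOrdinary)
    (hCassels : bsdRHS_eq_of_isIsogenous)
    (W : WeierstrassCurve ℚ) [W.IsElliptic] [W.IsGloballyMinimal] (p : ℕ) [Fact p.Prime]
    {W' : WeierstrassCurve ℚ} [W'.IsElliptic] [W'.IsGloballyMinimal] (hiso : IsIsogenous W W')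
    (hX : ClassX12 W p) (hp7 : 7 < p) (hnr : ¬ CMRamified W p) (hns : ¬ CMSplit W p) :
    BSDp W p ↔ MissingLowerBoundAt W' p :=
  bsdp_iff_missingLowerBoundAt_of_isIsogenous_of_classX12_of_cmInert hGZ hKo hMN hGZK hmod hnf hFH
    hCM8 hEdx deuring_not_hasUnitRootAt_of_hasCM_of_not_cmSplit_holds hCassels W p hiso hX hp7 hnr
    hns

/-- **`hDeu`-free form of `bsdp_of_classX12_of_cmInert_of_shaAn_unit`** — the same statement with
the binder `(hDeu : deuring_not_hasUnitRootAt_of_hasCM_of_not_cmSplit)` REMOVED: Deuring's criterion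
(supersingular half) is the tree theorem `deuring_not_hasUnitRootAt_of_hasCM_of_not_cmSplit_holds`
(p253190); proof = the original applied to it. [cite: EdixhovenManin1991, Thm. 3]
[cite: MatarNekovar2019, Thm. 0.3 and §0.11] [cite: Lang1987, Ch. 13 §4 Thm. 12] -/
theorem bsdp_of_classX12_of_cmInert_of_shaAn_unit'
    (hGZ : ∀ (N : ℕ) [NeZero N] (W : WeierstrassCurve ℚ) (K : Type) [Field K] [NumberField K],
      gross_zagier N W K)
    (hKo : ∀ (N : ℕ) [NeZero N] (W : WeierstrassCurve ℚ) (K : Type) [Field K] [NumberField K],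
      kolyvagin N W K)
    (hMN : ∀ (N : ℕ) [NeZero N] (W : WeierstrassCurve ℚ) (K : Type) [Field K] [NumberField K],
      MatarNekovar2019.thm03_padicValNat_card_sha_le_of_irreducible N W K)
    (hGZK : rank_eq_analyticRank_of_analyticRank_le_one) (hmod : hasEntireLFunction_rat)
    (hnf : exists_isNewformOf) (hFH : friedbergHoffstein_exists_heegnerField_split_twist_ne_zero)
    (hCM8 : bsdTriple_of_hasCM_of_L_one_ne_zero)
    (hEdx : edixhoven_not_dvd_maninConstant_of_not_potentiallyGoodOrdinary)
    (hCassels : bsdRHS_eq_of_isIsogenous)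
    (W : WeierstrassCurve ℚ) [W.IsElliptic] [W.IsGloballyMinimal] (p : ℕ) [Fact p.Prime]
    (hX : ClassX12 W p) (hp7 : 7 < p)
    (hnr : ¬ CMRamified W p) (hns : ¬ CMSplit W p) {q : ℚ} (hq : shaAn W = (q : ℂ))
    (hv : padicValRat p q = 0) : BSDp W p :=
  bsdp_of_classX12_of_cmInert_of_shaAn_unit hGZ hKo hMN hGZK hmod hnf hFH hCM8 hEdx
    deuring_not_hasUnitRootAt_of_hasCM_of_not_cmSplit_holds hCassels W p hX hp7 hnr hns hq hv

end Summit.BirchSwinnertonDyer.Rank1Residual.X12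

end
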